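import Literature.AnabelianGeometry.SemiGraphs.TemperedCompactInVerticialFinite
import HarnessLib

/-!
# [SemiAnbd] Theorem 3.7 (iii)/(iv) — the FINITE-GRAPH named forms, and their discharge

Mochizuki, *Semi-graphs of anabelioids*, Publ. RIMS **42** (2006), Thm. 3.7 (iii), (iv), manuscript
pp. 40–41 [cite: MochizukiSemiAnbd2006, Thm 3.7(iii)(iv) pp.40-41]; proof p. 41 l. 30 "Since the
semi-graphs `𝔾_j` are all finite, we thus conclude that we may choose a compatible system of such
subjoints" — print's proof of (iii) is a proof for FINITE underlying semi-graphs `𝔾`.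

Cell ruling α58 (1) (abc-iut L3-lead, 2026-08-26): the statements of record for consumers of
Thm. 3.7 (iii)/(iv) are the FINITE-GRAPH forms (the ∀-countable frozen facts `CompactInVerticial`,
`MaximalCompactIffVerticial`, `EdgeLikeIsInfVerticial`, `EdgeLikeDistinct` carry a desk countermodel at an
infinite ray of anabelioids and are left untouched).  This file NAMES the finite forms — each is the
per-graph predicate of `TemperedCompactInVerticialAt.lean` under the extra binders
`[Finite 𝒢.graph.Vertex] [Finite 𝒢.graph.Edge]` — so that they can be cited by name, and DISCHARGES each
of them from the kernel theorems of `TemperedCompactInVerticialFinite.lean`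
(`compactInVerticialAt_of_finiteGraph` and its three companions).  It also records that each
∀-countable frozen fact implies its finite form (trivially).  No new mathematics; nothing here asserts
Thm. 3.7 (iii) for an infinite `𝔾`; nothing here bears on [IUTchIII] Cor. 3.12.
-/

namespace Literature.AnabelianGeometry.SemiGraphs

namespace ProfiniteSemiGraph

universe u

/-- **[SemiAnbd] Thm. 3.7 (iii), finite-graph form**: for every semi-graph of anabelioids `𝒢` (local
presentation) whose underlying semi-graph has finitely many vertices and edges, `CompactInVerticialAt 𝒢`
(under the hypotheses of Thm. 3.7, every compact subgroup of `π₁^temp(𝒢)` lies in a verticial subgroup;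
a nontrivial one lies in at most two, and then in an edge-like subgroup of a closed edge).
[cite: MochizukiSemiAnbd2006, Thm 3.7(iii) pp.40-41] -/
def CompactInVerticialFin : Prop :=
  ∀ (𝒢 : ProfiniteSemiGraph.{u}) [Finite 𝒢.graph.Vertex] [Finite 𝒢.graph.Edge], CompactInVerticialAt 𝒢

/-- **[SemiAnbd] Thm. 3.7 (iv), finite-graph form**: `MaximalCompactIffVerticialAt 𝒢` for every `𝒢` with
finite underlying semi-graph. [cite: MochizukiSemiAnbd2006, Thm 3.7(iv) p.41] -/
def MaximalCompactIffVerticialFin : Prop :=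
  ∀ (𝒢 : ProfiniteSemiGraph.{u}) [Finite 𝒢.graph.Vertex] [Finite 𝒢.graph.Edge],
    MaximalCompactIffVerticialAt 𝒢

/-- The rung-4 residual of Thm. 3.7 (iv), finite-graph form: `EdgeLikeIsInfVerticialAt 𝒢` for every `𝒢`
with finite underlying semi-graph. [cite: MochizukiSemiAnbd2006, Thm 3.7(iv) p.41] -/
def EdgeLikeIsInfVerticialFin : Prop :=
  ∀ (𝒢 : ProfiniteSemiGraph.{u}) [Finite 𝒢.graph.Vertex] [Finite 𝒢.graph.Edge],
    EdgeLikeIsInfVerticialAt 𝒢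

/-- Thm. 3.7 (ii) in edge form, finite-graph form: `EdgeLikeDistinctAt 𝒢` for every `𝒢` with finite
underlying semi-graph. [cite: MochizukiSemiAnbd2006, Thm 3.7(ii)(iv) pp.40-41] -/
def EdgeLikeDistinctFin : Prop :=
  ∀ (𝒢 : ProfiniteSemiGraph.{u}) [Finite 𝒢.graph.Vertex] [Finite 𝒢.graph.Edge], EdgeLikeDistinctAt 𝒢

/-! ### Discharge (kernel theorems of the cell, `TemperedCompactInVerticialFinite.lean`) -/

/-- **Thm. 3.7 (iii) holds at every finite `𝔾`** (`compactInVerticialAt_of_finiteGraph`).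
[cite: MochizukiSemiAnbd2006, Thm 3.7(iii) pp.40-41] -/
theorem compactInVerticialFin_holds : CompactInVerticialFin.{u} :=
  fun _ _ _ => compactInVerticialAt_of_finiteGraph

/-- `CompactInVerticialFin` — `_holds` alias of `compactInVerticialFin_holds` above under the fact's exact name (appended
2026-08-28, D-0026 bookkeeping: the proof term is the existing theorem of this file; no statement,
definition or attribute is edited; no new named fact; the ledger's debt table listed the fact
unproved). [cite: MochizukiSemiAnbd2006, Thm 3.7(iii) pp.40-41] -/
theorem _root_.Literature.AnabelianGeometry.SemiGraphs.ProfiniteSemiGraph.CompactInVerticialFin_holds :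
    CompactInVerticialFin.{u} :=
  _root_.Literature.AnabelianGeometry.SemiGraphs.ProfiniteSemiGraph.compactInVerticialFin_holds

/-- **Thm. 3.7 (iv) holds at every finite `𝔾`** (`maximalCompactIffVerticialAt_of_finiteGraph`).
[cite: MochizukiSemiAnbd2006, Thm 3.7(iv) p.41] -/
theorem maximalCompactIffVerticialFin_holds : MaximalCompactIffVerticialFin.{u} :=
  fun _ _ _ => maximalCompactIffVerticialAt_of_finiteGraph

/-- `MaximalCompactIffVerticialFin` — `_holds` alias of `maximalCompactIffVerticialFin_holds` above under the fact's exact name (appended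
2026-08-28, D-0026 bookkeeping: the proof term is the existing theorem of this file; no statement,
definition or attribute is edited; no new named fact; the ledger's debt table listed the fact
unproved). [cite: MochizukiSemiAnbd2006, Thm 3.7(iv) p.41] -/
theorem _root_.Literature.AnabelianGeometry.SemiGraphs.ProfiniteSemiGraph.MaximalCompactIffVerticialFin_holds :
    MaximalCompactIffVerticialFin.{u} :=
  _root_.Literature.AnabelianGeometry.SemiGraphs.ProfiniteSemiGraph.maximalCompactIffVerticialFin_holds

/-- The rung-4 residual holds at every finite `𝔾` (`edgeLikeIsInfVerticialAt_of_finiteGraph`).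
[cite: MochizukiSemiAnbd2006, Thm 3.7(iv) p.41] -/
theorem edgeLikeIsInfVerticialFin_holds : EdgeLikeIsInfVerticialFin.{u} :=
  fun _ _ _ => edgeLikeIsInfVerticialAt_of_finiteGraph

/-- `EdgeLikeIsInfVerticialFin` — `_holds` alias of `edgeLikeIsInfVerticialFin_holds` above under the fact's exact name (appended
2026-08-28, D-0026 bookkeeping: the proof term is the existing theorem of this file; no statement,
definition or attribute is edited; no new named fact; the ledger's debt table listed the fact
unproved). [cite: MochizukiSemiAnbd2006, Thm 3.7(iv) p.41] -/
theorem _root_.Literature.AnabelianGeometry.SemiGraphs.ProfiniteSemiGraph.EdgeLikeIsInfVerticialFin_holds :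
    EdgeLikeIsInfVerticialFin.{u} :=
  _root_.Literature.AnabelianGeometry.SemiGraphs.ProfiniteSemiGraph.edgeLikeIsInfVerticialFin_holds

/-- `EdgeLikeDistinct` holds at every finite `𝔾` (`edgeLikeDistinctAt_of_finiteGraph`).
[cite: MochizukiSemiAnbd2006, Thm 3.7(ii)(iv) pp.40-41] -/
theorem edgeLikeDistinctFin_holds : EdgeLikeDistinctFin.{u} :=
  fun _ _ _ => edgeLikeDistinctAt_of_finiteGraph

/-- `EdgeLikeDistinctFin` — `_holds` alias of `edgeLikeDistinctFin_holds` above under the fact's exact name (appended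
2026-08-28, D-0026 bookkeeping: the proof term is the existing theorem of this file; no statement,
definition or attribute is edited; no new named fact; the ledger's debt table listed the fact
unproved). [cite: MochizukiSemiAnbd2006, Thm 3.7(ii)(iv) pp.40-41] -/
theorem _root_.Literature.AnabelianGeometry.SemiGraphs.ProfiniteSemiGraph.EdgeLikeDistinctFin_holds :
    EdgeLikeDistinctFin.{u} :=
  _root_.Literature.AnabelianGeometry.SemiGraphs.ProfiniteSemiGraph.edgeLikeDistinctFin_holds

/-! ### The ∀-countable frozen facts imply the finite forms -/

/-- The frozen ∀-countable fact `CompactInVerticial` specialises to the finite form.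
[cite: MochizukiSemiAnbd2006, Thm 3.7(iii) pp.40-41] -/
theorem compactInVerticialFin_of_compactInVerticial (h : CompactInVerticial.{u}) :
    CompactInVerticialFin.{u} :=
  fun 𝒢 _ _ => compactInVerticial_iff_forall_at.mp h 𝒢

/-- The frozen ∀-countable fact `MaximalCompactIffVerticial` specialises to the finite form.
[cite: MochizukiSemiAnbd2006, Thm 3.7(iv) p.41] -/
theorem maximalCompactIffVerticialFin_of_maximalCompactIffVerticial
    (h : MaximalCompactIffVerticial.{u}) : MaximalCompactIffVerticialFin.{u} :=
  fun 𝒢 _ _ => maximalCompactIffVerticial_iff_forall_at.mp h 𝒢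

/-- The frozen ∀-countable fact `EdgeLikeIsInfVerticial` specialises to the finite form.
[cite: MochizukiSemiAnbd2006, Thm 3.7(iv) p.41] -/
theorem edgeLikeIsInfVerticialFin_of_edgeLikeIsInfVerticial (h : EdgeLikeIsInfVerticial.{u}) :
    EdgeLikeIsInfVerticialFin.{u} :=
  fun 𝒢 _ _ => edgeLikeIsInfVerticial_iff_forall_at.mp h 𝒢

/-- The frozen ∀-countable fact `EdgeLikeDistinct` specialises to the finite form.
[cite: MochizukiSemiAnbd2006, Thm 3.7(ii)(iv) pp.40-41] -/
theorem edgeLikeDistinctFin_of_edgeLikeDistinct (h : EdgeLikeDistinct.{u}) :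
    EdgeLikeDistinctFin.{u} :=
  fun 𝒢 _ _ => edgeLikeDistinct_iff_forall_at.mp h 𝒢

/-- At a finite `𝔾`, the finite form gives the per-graph predicate (by-name access for consumers).
[cite: MochizukiSemiAnbd2006, Thm 3.7(iii) pp.40-41] -/
theorem compactInVerticialAt_of_fin (h : CompactInVerticialFin.{u}) (𝒢 : ProfiniteSemiGraph.{u})
    [Finite 𝒢.graph.Vertex] [Finite 𝒢.graph.Edge] : CompactInVerticialAt 𝒢 :=
  h 𝒢

/-- At a finite `𝔾`, the finite form of (iv) gives the per-graph predicate.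
[cite: MochizukiSemiAnbd2006, Thm 3.7(iv) p.41] -/
theorem maximalCompactIffVerticialAt_of_fin (h : MaximalCompactIffVerticialFin.{u})
    (𝒢 : ProfiniteSemiGraph.{u}) [Finite 𝒢.graph.Vertex] [Finite 𝒢.graph.Edge] :
    MaximalCompactIffVerticialAt 𝒢 :=
  h 𝒢

end ProfiniteSemiGraph

end Literature.AnabelianGeometry.SemiGraphs
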